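import Literature.AlgebraicGeometry.Motives.GeneratesBaseChange
import Literature.AlgebraicGeometry.Motives.AlbaneseExistenceComplex
import Literature.AlgebraicGeometry.Motives.CurveLinearSystemMorphism
import Literature.AlgebraicGeometry.Motives.AlgPointsSeparate
import Literature.AlgebraicGeometry.Motives.BaseChangeProofs
import HarnessLib

/-!
# The base change of an Albanese variety receives a SURJECTION from the Albanese variety of the
# base change (Serre, *Morphismes universels*, no. 2; Milne, *Jacobian Varieties*, Prop. 6.1)

Let `Z` be a proper geometrically integral scheme over a field `K` with a rational point `P ∈ Z(K)`,
`𝒥` an Albanese datum of `Z` in Milne's difference-map form (`Motives.Jacobian Z`: `J = J(Z)` with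
`[x − y] : Z × Z → J`, universal), `L / K` a field extension and `𝒥'` an Albanese datum of
`Z_L = Z ×_K L`.  The universal property of `𝒥'` applied to the base change `[x − y]_L` of the
difference map of `𝒥` gives THE COMPARISON HOMOMORPHISM `u : J(Z_L) → J(Z) ×_K L`, and

* `Jacobian.exists_hom_baseChange_surjective` — **`u` is SURJECTIVE**: the Abel–Jacobi map
  `f^P : Z → J` generates `J` (Serre no. 2, Thm. 1 ⇒ `generates_abelJacobi`), generation is stable
  under extension of the base field (`Generates.baseChange`), `(f^P)_L` factors through `u`, and a
  homomorphism through which a generating map factors is surjective (Serre, proof of Thm. 2;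
  `Generates.surjective_of_comp_eq`).

This is the formal half of «the Albanese variety commutes with base change» that needs no dimension
count and no descent: the other half (injectivity of `u`, finiteness of its kernel being automatic
from a dimension count only when `dim J(Z_L) ≤ dim J(Z)` is known) is Grothendieck's base-change
theorem for `Alb = (Pic⁰_red)^∨` (FGA VI, Thm. 3.3 (iii); Achter–Casalaina-Martin–Vial, Thm. 3.2) and
is NOT proved here.  Also:

* `AbelianVariety.eq_zero_of_surjective_comp_eq_zero` — over an algebraically closed field a
  SURJECTIVE homomorphism `u : P → A` kills no non-zero homomorphism: `u ≫ f = 0 ⇒ f = 0` (rational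
  points lift along surjective morphisms and separate morphisms from a reduced scheme; Mumford §4).
* `Jacobian.exists_jacobian_hom_baseChange_surjective_complex` — the case `L = ℂ`, `Z` smooth
  projective geometrically irreducible with a `K`-point: the complex Albanese datum of `Z_ℂ` exists
  (tree `nonempty_jacobian_of_isSmoothProjective_complex_of_dim`) and maps ONTO `J(Z) ×_K ℂ`.

Use (cell pub-hodgecm2, TEAM hComp, de-citing `Liu2021.albanese_baseChange` at its consumer): the
`hAlb`-binder of the COR-CM `hComp` closer only needs, out of `Alb_{X_K} ⊗_E ℂ`, a family of
homomorphisms from complex Jacobians of the pieces that is jointly epimorphic; surjections suffice.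
Everything here is proved; no definition, no named fact (D-0026).  HC_CM is NOT proved.

## References

* J.-P. Serre, *Morphismes universels et variété d'Albanese*, Sém. Chevalley 4 (1958/59), exp. 10,
  no. 2, Thm. 1, Thm. 2 (proof: «`h` est nécessairement surjectif, puisque `f'` engendre `A'`»).
  [Serre1958MorphismesUniversels]
* J. S. Milne, *Jacobian Varieties*, in Cornell–Silverman, *Arithmetic Geometry* (1986), §6
  Prop. 6.1 (proof: «`f^P(C)` generates `J`»), Prop. 6.4, Remark 6.5. [Milne1986JacobianVarieties]
* S. Lang, *Abelian Varieties* (1959/1983), II §3 (p. 35: generation and base change).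
  [Lang1983AbelianVarieties]
* D. Mumford, *Abelian Varieties* (1970), §4 (points over an algebraically closed field separate
  morphisms). [MumfordAV1970]
-/

noncomputable section

open CategoryTheory CategoryTheory.Limits AlgebraicGeometry MonoidalCategory CartesianMonoidalCategory

universe u

namespace Literature.AlgebraicGeometry.Motives

open AbelianVariety (bcSpec bcFunctor)
open scoped MonObj

set_option backward.isDefEq.respectTransparency false

/-! ### §1 A surjective homomorphism kills no non-zero homomorphism -/

namespace AbelianVariety

variable {K : Type u} [Field K] [IsAlgClosed K] {P A B : AbelianVariety K}

/-- **Over an algebraically closed field, a SURJECTIVE homomorphism of abelian varieties `u : P → A`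
kills no non-zero homomorphism**: `u ≫ f = 0` implies `f = 0`.  Every `K`-point `Q` of `A` lifts to a
`K`-point `R` of `P` (`AlgPoints.exists_comp_eq_of_surjective`), so `f(Q) = f(u(R)) = 0`; and
`K`-points separate `K`-morphisms out of the reduced scheme `A` (Mumford §4;
`SchemeOver.hom_ext_of_forall_algPoints`). [cite: MumfordAV1970, §4] -/
theorem eq_zero_of_surjective_comp_eq_zero (u : P ⟶ A) [hu : Surjective (Hom.toSchemeHom u)]
    {f : A ⟶ B} (h : u ≫ f = 0) : f = 0 := by
  apply hom_ext
  haveI : IsReduced A.X.left := isReduced_left A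
  haveI : Surjective u.hom.hom.hom.left := hu
  refine SchemeOver.hom_ext_of_forall_algPoints K fun Q => ?_
  obtain ⟨R, rfl⟩ := AlgPoints.exists_comp_eq_of_surjective u.hom.hom.hom Q
  change R ≫ (u ≫ f).hom.hom.hom = R ≫ (u ≫ (0 : A ⟶ B)).hom.hom.hom
  rw [h, comp_zero]

end AbelianVariety

/-! ### §2 The comparison homomorphism `J(Z_L) → J(Z)_L` and its surjectivity -/

namespace Jacobian

variable {K : Type u} [Field K] (L : Type u) [Field L] [Algebra K L] {Z : SchemeOver K}
  [IsProper Z.hom] [GeometricallyIntegral Z.hom] (𝒥 : Jacobian Z) (𝒥' : Jacobian ((bcFunctor K L).obj Z))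

omit [IsProper Z.hom] [GeometricallyIntegral Z.hom] in
/-- The base change `[x − y]_L : Z_L × Z_L → J_L` of the difference map (read on `Z_L × Z_L` through
the monoidal structure isomorphism `Z_L × Z_L ≅ (Z × Z)_L` of the base-change functor) is trivial on
the diagonal. [cite: Milne1986JacobianVarieties, §6 (before Prop. 6.4)] -/
theorem diag_μ_map_diff :
    lift (𝟙 _) (𝟙 _) ≫ ((Functor.Monoidal.μIso (bcFunctor K L) Z Z).hom ≫ (bcFunctor K L).map 𝒥.diff :
      (bcFunctor K L).obj Z ⊗ (bcFunctor K L).obj Z ⟶ (𝒥.J.baseChange L).X) = 1 := by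
  rw [← Category.assoc, Functor.Monoidal.μIso_hom, ← (bcFunctor K L).map_id, Functor.Monoidal.lift_μ,
    ← Functor.map_comp, 𝒥.diag_diff]
  exact Functor.map_one (bcFunctor K L)

/-- **The comparison homomorphism `J(Z_L) → J(Z) ×_K L` is surjective.**  For a proper geometrically
integral `Z / K` with a rational point `P`, an Albanese datum `𝒥` of `Z` and an Albanese datum `𝒥'`
of `Z_L`, there is a homomorphism `u : J(Z_L) → J(Z)_L` with `[x − y]' ≫ u = [x − y]_L` (the universal
property of `𝒥'`), and every such `u` is SURJECTIVE: `(f^P)_L = (f'^{P}) ≫ u` for the Abel–Jacobi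
maps, `(f^P)_L` generates `J(Z)_L` (`generates_abelJacobi`, `Generates.baseChange`), hence `u` is
surjective (`Generates.surjective_of_comp_eq`).
[cite: Serre1958MorphismesUniversels, no. 2 Thm. 1 and proof of Thm. 2]
[cite: Milne1986JacobianVarieties, §6 Prop. 6.1 (proof) and Prop. 6.4] -/
theorem exists_hom_baseChange_surjective (P : AlgPoints Z K) :
    ∃ u : 𝒥'.J ⟶ 𝒥.J.baseChange L,
      𝒥'.diff ≫ u.hom.hom.hom =
        (Functor.Monoidal.μIso (bcFunctor K L) Z Z).hom ≫ (bcFunctor K L).map 𝒥.diff ∧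
      Surjective (AbelianVariety.Hom.toSchemeHom u) := by
  have hdiag := 𝒥.diag_μ_map_diff L
  refine ⟨𝒥'.desc _ hdiag, 𝒥'.fac _ hdiag, ?_⟩
  -- the base-changed Abel–Jacobi map generates `J_L` …
  have hgen : Generates (A := 𝒥.J.baseChange L) ((bcFunctor K L).map (𝒥.abelJacobi P)) :=
    (𝒥.generates_abelJacobi P).baseChange L
  -- … and factors through `u`: `(f^P)_L = (x ↦ [x − P]') ≫ u`
  refine hgen.surjective_of_comp_eq (𝒥'.desc _ hdiag)
    (g := lift (𝟙 _) ((bcFunctor K L).map (toSpecOver Z ≫ P)) ≫ 𝒥'.diff) ?_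
  rw [Category.assoc, 𝒥'.fac _ hdiag, ← Category.assoc, Functor.Monoidal.μIso_hom,
    ← (bcFunctor K L).map_id, Functor.Monoidal.lift_μ, ← Functor.map_comp]
  rfl

/-- **Over `ℂ`: the complex Albanese variety of `Z_ℂ` maps ONTO `J(Z) ×_K ℂ`.**  For `K ⊆ ℂ`
(`[Algebra K ℂ]`), `Z` smooth projective geometrically irreducible of dimension `d` over `K` with a
`K`-point `P` and an Albanese datum `𝒥`, the base change `Z_ℂ` has an Albanese datum `𝒥'` (tree
`nonempty_jacobian_of_isSmoothProjective_complex_of_dim`) and a SURJECTIVE homomorphism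
`J(Z_ℂ) → J(Z) ×_K ℂ`. [cite: Serre1958MorphismesUniversels, no. 2 Thm. 1 and proof of Thm. 2]
[cite: Milne1986JacobianVarieties, §6 Prop. 6.1 and Prop. 6.4] -/
theorem exists_jacobian_hom_baseChange_surjective_complex {K : Type} [Field K] [Algebra K ℂ] {d : ℕ}
    {Z : SchemeOver K} (hZ : IsSmoothProjective d Z) (𝒥 : Jacobian Z) (P : AlgPoints Z K) :
    ∃ (𝒥' : Jacobian ((bcFunctor K ℂ).obj Z)) (u : 𝒥'.J ⟶ 𝒥.J.baseChange ℂ),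
      Surjective (AbelianVariety.Hom.toSchemeHom u) := by
  haveI := IsSmoothProjective.isProper_holds hZ
  haveI := IsSmoothProjective.geometricallyIntegral_holds hZ
  obtain ⟨𝒥'⟩ := nonempty_jacobian_of_isSmoothProjective_complex_of_dim ((bcFunctor K ℂ).obj Z)
    (hZ.baseChange_obj ℂ)
  obtain ⟨u, -, hu⟩ := 𝒥.exists_hom_baseChange_surjective ℂ 𝒥' P
  exact ⟨𝒥', u, hu⟩

end Jacobian

end Literature.AlgebraicGeometry.Motives

end
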